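/-
Copyright (c) 2026. All rights reserved.
Released under Apache 2.0 license as described in the file LICENSE.
Authors: abc-iut cell, prover seat abc-iut-w5-d064 (wave 5, gen 4).
-/
import Summits.ABC.IUTFork.Cor312Ind3IteratesVacuityRamificationCriterion
import Literature.IUT.LogVolume.UnitLogTorsionPowerCriterion
import HarnessLib

/-!
# (Ind3) honest iterates at DYADIC places: depth `≥ 2` is inhabited ⟺ a unit equation in `K_v`

Proof-only sequel (theorems, no definitions) of the honest-model census of the [IUTchIII] log-link
iterates (`Real.nonarchIterImage (analyticLogv F) v m′`, abc-iut-w4-d029 / abc-iut-c312-5) at the finite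
places `v ∣ 2` of a number field `F`.  Census of record (abc-iut-w5-d017, 2026-08-26T09:19Z, kernel):
at `v ∣ 2` the depth-`≥ 2` images are EMPTY if `e(v|2)` is odd or if `f(v|2) = 1 ∧ e(v|2) ≡ 2 (mod 4)`,
INHABITED at depth `2` if `2 ∣ e(v|2) ∧ f(v|2) ≥ 2`, and «`f(v|2) = 1 ∧ 4 ∣ e(v|2)`: undecided — field
dependent» (abc-iut-S1: both answers occur at `(e, f) = (4, 1)`).  So NO criterion in terms of `(e, f)`
exists; THIS FILE gives the criterion that does exist, uniformly in `F` and `v`, by transporting the local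
TORSION–POWER CRITERION `Literature.IUT.LogVolume.TorsionPowerCriterion.Dyadic.exists_norm_unitLog_eq_one_iff`
(«some unit of `𝒪_K` has a unit `2`-adic logarithm ⟺ `R^μ·(𝒪_K^×)⁴` meets the sphere `‖1 − w‖ = ‖4‖`»,
every finite `K/ℚ₂`) to the completions `F_v` through abc-iut-S7's rescaled completion:

* `Real.nonarchIterImage_analyticLogv_two_nonempty_iff_exists_unit` — **any residue characteristic**:
  the honest depth-`2` image at `v` is inhabited iff SOME `log_v(w)`, `w ∈ O_v^×`, is a unit of `O_v`
  (the two halves were in the tree: abc-iut-w5-d230's boundary lemma and the emptiness pattern);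
  rescaled form `…_iff_exists_norm_unitLog_eq_one`; all-depths form
  `Real.forall_nonarchIterImage_add_two_eq_empty_iff_forall_ne_one`.
* `Real.nonarchIterImage_analyticLogv_two_nonempty_iff_of_residueChar_eq_two` — **`v ∣ 2`: the honest
  depth-`2` (Ind3) image at `v` is INHABITED iff there are a root of unity `ζ ∈ K_v` and a unit `w ∈ O_v^×`
  with `‖1 − ζ·w⁴‖_v = ‖4‖_v`** (in `K_v`'s own norm); EMPTY at every depth `≥ 2` iff that unit equation
  has no solution (`Real.forall_nonarchIterImage_add_two_eq_empty_iff_of_residueChar_eq_two`).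
* packet level: `Real.tprodImages_honestU_add_two_eq_empty_of_forall_ne_of_residueChar_eq_two`.

E.g. (abc-iut-S1) `K_v ∋ θ`, `θ⁴ = 3`: `ζ = −1`, `w = θ` solves it (`‖1 + 3‖ = ‖4‖`), so depth `2` is
inhabited at the place of `ℚ(3^{1/4})` over `2` (`e = 4`, `f = 1`), while at the place of `ℚ(2^{1/4})`
(`e = 4`, `f = 1` as well) it is not.  Honest framing: statements ABOUT THE MODEL (which typed (Ind3)
containments are `∅ ⊆ _`); classical local arithmetic underneath (Koblitz IV §1–2, Neukirch II (5.5));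
nothing here asserts or denies [IUTchIII] Cor. 3.12 or takes a side; census ≠ verdict; typed ≠ proved.
No definitions, no Prop-valued fact (D-0067 (1)).
-/

noncomputable section

open Set

namespace Summit.ABC.IUTFork.Thm311.Real

open NumberField IsDedekindDomain Literature.IUT.LogVolume Literature.IUT.LogThetaLattice
  Literature.NumberTheory.NumberFields

variable {F : Type} [Field F] [NumberField F]

/-! ## 1. Any residue characteristic: depth `2` is inhabited iff some `log_v(w)` is a unit -/

/-- If the honest depth-`2` image at `v` is inhabited, some unit `w ∈ O_v^×` has `‖log_v(w)‖' = 1` (every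
depth-`2` element is `log_v(u)` for a unit `u = log_v(w)` of depth `1`). [claim: Mochizuki2012, status: disputed] -/
theorem exists_norm_of_analyticLogv_eq_one_of_nonarchIterImage_two_nonempty (v : HeightOneSpectrum (𝓞 F))
    (h : (nonarchIterImage (analyticLogv F) v 2).Nonempty) :
    ∃ w : (↥(integers v))ˣ, ‖RescaledCompletion.of F (residueChar F v) v (natCast_residueChar_mem F v)
        (analyticLogv F v (Additive.ofMul w))‖ = 1 := by
  obtain ⟨_, u, hu, rfl⟩ := h
  obtain ⟨w, hw⟩ := nonarchIterImage_succ_subset_range (analyticLogv F) v 0 hu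
  refine ⟨w, ?_⟩
  dsimp only at hw
  rw [hw]
  exact norm_of_coe_unit_adicCompletionIntegers F (residueChar F v) v (natCast_residueChar_mem F v) u

/-- **Depth `2` is inhabited at `v` iff some `log_v(w)`, `w ∈ O_v^×`, is a unit of `O_v`** — for EVERY finite
place `v`, every residue characteristic (the «only way (Ind3) content can appear at depth `≥ 2`», now an
equivalence). [claim: Mochizuki2012, status: disputed] -/
theorem nonarchIterImage_analyticLogv_two_nonempty_iff_exists_unit (v : HeightOneSpectrum (𝓞 F)) :
    (nonarchIterImage (analyticLogv F) v 2).Nonempty ↔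
      ∃ w : (↥(integers v))ˣ, ‖RescaledCompletion.of F (residueChar F v) v (natCast_residueChar_mem F v)
        (analyticLogv F v (Additive.ofMul w))‖ = 1 := by
  refine ⟨exists_norm_of_analyticLogv_eq_one_of_nonarchIterImage_two_nonempty v, fun ⟨w, hw⟩ ↦ ?_⟩
  obtain ⟨u, hu⟩ := exists_unit_coe_eq_of_norm_rescaled_eq_one v (residueChar F v)
    (natCast_residueChar_mem F v) (analyticLogv F v (Additive.ofMul w)) hw
  exact nonarchIterImage_two_nonempty_of_exists_eq_coe_unit (analyticLogv F) v ⟨w, u, hu.symm⟩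

/-- All depths at once: EVERY honest image of depth `≥ 2` at `v` is empty iff NO `log_v(w)`, `w ∈ O_v^×`, has
`‖log_v(w)‖' = 1`. [claim: Mochizuki2012, status: disputed] -/
theorem forall_nonarchIterImage_add_two_eq_empty_iff_forall_ne_one (v : HeightOneSpectrum (𝓞 F)) :
    (∀ k : ℕ, nonarchIterImage (analyticLogv F) v (k + 2) = ∅) ↔
      ∀ w : (↥(integers v))ˣ, ‖RescaledCompletion.of F (residueChar F v) v (natCast_residueChar_mem F v)
        (analyticLogv F v (Additive.ofMul w))‖ ≠ 1 := by
  constructor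
  · intro h w hw
    have h2 := (nonarchIterImage_analyticLogv_two_nonempty_iff_exists_unit v).mpr ⟨w, hw⟩
    rw [h 0] at h2
    exact Set.not_nonempty_empty h2
  · intro h k
    refine nonarchIterImage_add_two_eq_empty_of_forall_ne (analyticLogv F) v (fun w u hwu ↦ ?_) k
    refine h w ?_
    rw [hwu]
    exact norm_of_coe_unit_adicCompletionIntegers F (residueChar F v) v (natCast_residueChar_mem F v) u

/-- Rescaled form: depth `2` is inhabited at `v` iff some element of norm `1` of abc-iut-S7's rescaled
completion `F_v` (a normed `ℚ_{p_v}`-algebra) has a `p_v`-adic logarithm of norm `1` — the hypothesis shape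
of the local criteria in `Literature/IUT/LogVolume/UnitLog*.lean`. [claim: Mochizuki2012, status: disputed] -/
theorem nonarchIterImage_analyticLogv_two_nonempty_iff_exists_norm_unitLog_eq_one
    (v : HeightOneSpectrum (𝓞 F)) [Fact (residueChar F v).Prime] :
    (nonarchIterImage (analyticLogv F) v 2).Nonempty ↔
      ∃ y : RescaledCompletion F (residueChar F v) v (natCast_residueChar_mem F v),
        ‖y‖ = 1 ∧ ‖unitLog y‖ = 1 := by
  rw [nonarchIterImage_analyticLogv_two_nonempty_iff_exists_unit]
  constructor
  · rintro ⟨w, hw⟩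
    refine ⟨RescaledCompletion.of F (residueChar F v) v (natCast_residueChar_mem F v)
        (((w : ↥(integers v))) : Carrier (.inr v : Place F)),
      norm_of_coe_unit_adicCompletionIntegers F (residueChar F v) v (natCast_residueChar_mem F v) w, ?_⟩
    rw [analyticLogv_apply, RingEquiv.apply_symm_apply] at hw
    exact hw
  · rintro ⟨y, hy, hlog⟩
    obtain ⟨w, hw⟩ := exists_unit_coe_eq_of_norm_rescaled_eq_one v (residueChar F v)
      (natCast_residueChar_mem F v)
      ((RescaledCompletion.of F (residueChar F v) v (natCast_residueChar_mem F v)).symm y)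
      (by rw [RingEquiv.apply_symm_apply]; exact hy)
    refine ⟨w, ?_⟩
    rw [analyticLogv_apply, RingEquiv.apply_symm_apply]
    have hw' : RescaledCompletion.of F (residueChar F v) v (natCast_residueChar_mem F v)
        (((w : ↥(v.adicCompletionIntegers F))) : v.adicCompletion F) = y := by
      rw [hw, RingEquiv.apply_symm_apply]
    rw [hw']
    exact hlog

/-! ## 2. Transport lemmas along the rescaling `K_v = F_v` (the identity on elements) -/

/-- The rescaled norms of two elements agree iff their `v`-adic norms agree (`‖x‖' = ‖x‖_v^{1/n_v}`).
[cite: NeukirchANT1999, Ch. II Prop. (3.3)] -/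
theorem norm_rescaled_eq_iff (v : HeightOneSpectrum (𝓞 F)) (p : ℕ) (hv : ((p : ℕ) : 𝓞 F) ∈ v.asIdeal)
    (a b : v.adicCompletion F) :
    ‖RescaledCompletion.of F p v hv a‖ = ‖RescaledCompletion.of F p v hv b‖ ↔ ‖a‖ = ‖b‖ := by
  rw [RescaledCompletion.norm_of, RescaledCompletion.norm_of]
  exact Real.rpow_left_inj (norm_nonneg _) (norm_nonneg _)
    (one_div_ne_zero (Nat.cast_ne_zero.mpr (localDeg_pos F v).ne'))

/-- Roots of unity are the same in `K_v` and in the rescaled field (same underlying field).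
[cite: NeukirchANT1999, Ch. II (5.5)] -/
theorem isTorsionUnit_rescaled_iff (v : HeightOneSpectrum (𝓞 F)) (p : ℕ) [Fact p.Prime]
    (hv : ((p : ℕ) : 𝓞 F) ∈ v.asIdeal) (ζ : v.adicCompletion F) :
    IsTorsionUnit (RescaledCompletion F p v hv) (RescaledCompletion.of F p v hv ζ) ↔
      ∃ n : ℕ, 0 < n ∧ ζ ^ n = 1 := by
  unfold IsTorsionUnit
  refine exists_congr fun n ↦ and_congr Iff.rfl ?_
  rw [← map_pow, map_eq_one_iff _ (RescaledCompletion.of F p v hv).injective]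

/-- `‖4‖' = 4⁻¹` in the rescaled completion at a place over `2` (`p`-indexed for transport).
[cite: Koblitz1984, Ch. IV §1] -/
theorem norm_rescaled_four (v : HeightOneSpectrum (𝓞 F)) (p : ℕ) [Fact p.Prime]
    (hv : ((p : ℕ) : 𝓞 F) ∈ v.asIdeal) (hp2 : p = 2) :
    ‖RescaledCompletion.of F p v hv (4 : v.adicCompletion F)‖ = (4 : ℝ)⁻¹ := by
  subst hp2
  rw [map_ofNat]
  have h := TorsionPowerCriterion.Dyadic.norm_four (RescaledCompletion F 2 v hv)
  rw [Nat.cast_ofNat] at h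
  exact h

/-- **Local step, `p`-indexed for transport**: in the rescaled completion at a place over `p = 2`, some
element of norm `1` has a unit logarithm iff `‖1 − ζ·y⁴‖ = 4⁻¹` is solvable with `ζ` a root of unity and
`‖y‖ = 1` (`TorsionPowerCriterion.Dyadic.exists_norm_unitLog_eq_one_iff`). [cite: Koblitz1984, Ch. IV §2] -/
theorem exists_norm_unitLog_eq_one_iff_exists_torsion_mul_pow_four_rescaled (v : HeightOneSpectrum (𝓞 F))
    (p : ℕ) [Fact p.Prime] (hv : ((p : ℕ) : 𝓞 F) ∈ v.asIdeal) (hp2 : p = 2) :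
    (∃ y : RescaledCompletion F p v hv, ‖y‖ = 1 ∧ ‖unitLog y‖ = 1) ↔
      ∃ ζ y : RescaledCompletion F p v hv, IsTorsionUnit (RescaledCompletion F p v hv) ζ ∧ ‖y‖ = 1 ∧
        ‖1 - ζ * y ^ 4‖ = (4 : ℝ)⁻¹ := by
  subst hp2
  exact TorsionPowerCriterion.Dyadic.exists_norm_unitLog_eq_one_iff

/-! ## 3. The dyadic criterion at a place `v ∣ 2` -/

/-- **`v ∣ 2`, rescaled form**: the honest depth-`2` (Ind3) image at `v` is inhabited iff
`‖1 − ζ·y⁴‖' = 4⁻¹` for some root of unity `ζ` and some `‖y‖' = 1` of the rescaled completion.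
[claim: Mochizuki2012, status: disputed] -/
theorem nonarchIterImage_analyticLogv_two_nonempty_iff_rescaled_of_residueChar_eq_two
    (v : HeightOneSpectrum (𝓞 F)) [Fact (residueChar F v).Prime] (h2 : residueChar F v = 2) :
    (nonarchIterImage (analyticLogv F) v 2).Nonempty ↔
      ∃ ζ y : RescaledCompletion F (residueChar F v) v (natCast_residueChar_mem F v),
        IsTorsionUnit (RescaledCompletion F (residueChar F v) v (natCast_residueChar_mem F v)) ζ ∧
          ‖y‖ = 1 ∧ ‖1 - ζ * y ^ 4‖ = (4 : ℝ)⁻¹ := by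
  rw [nonarchIterImage_analyticLogv_two_nonempty_iff_exists_norm_unitLog_eq_one]
  exact exists_norm_unitLog_eq_one_iff_exists_torsion_mul_pow_four_rescaled v (residueChar F v)
    (natCast_residueChar_mem F v) h2

/-- **THE DYADIC CRITERION (`v ∣ 2`), in `K_v`'s own terms**: the honest depth-`2` (Ind3) iterate image at
`v` for the analytic logarithms is INHABITED iff there are a root of unity `ζ ∈ K_v` and a unit `w ∈ O_v^×`
with **`‖1 − ζ·w⁴‖_v = ‖4‖_v`** (i.e. `ζ w⁴ ≡ 1 (mod 4)`, `≢ 1 (mod 4𝔪_v)`).  No condition on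
`(e(v|2), f(v|2))` can replace this (abc-iut-S1's `(4, 1)` examples). [claim: Mochizuki2012, status: disputed] -/
theorem nonarchIterImage_analyticLogv_two_nonempty_iff_of_residueChar_eq_two (v : HeightOneSpectrum (𝓞 F))
    (h2 : residueChar F v = 2) :
    (nonarchIterImage (analyticLogv F) v 2).Nonempty ↔
      ∃ (ζ : v.adicCompletion F) (w : (↥(v.adicCompletionIntegers F))ˣ), (∃ n : ℕ, 0 < n ∧ ζ ^ n = 1) ∧
        ‖1 - ζ * (((w : ↥(v.adicCompletionIntegers F))) : v.adicCompletion F) ^ 4‖ =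
          ‖(4 : v.adicCompletion F)‖ := by
  haveI : Fact (residueChar F v).Prime := ⟨residueChar_prime F v⟩
  have h4 : ‖RescaledCompletion.of F (residueChar F v) v (natCast_residueChar_mem F v)
      (4 : v.adicCompletion F)‖ = (4 : ℝ)⁻¹ :=
    norm_rescaled_four v (residueChar F v) (natCast_residueChar_mem F v) h2
  rw [nonarchIterImage_analyticLogv_two_nonempty_iff_rescaled_of_residueChar_eq_two v h2]
  constructor
  · rintro ⟨ζ, y, hζ, hy, hζy⟩
    obtain ⟨w, hw⟩ := exists_unit_coe_eq_of_norm_rescaled_eq_one v (residueChar F v)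
      (natCast_residueChar_mem F v)
      ((RescaledCompletion.of F (residueChar F v) v (natCast_residueChar_mem F v)).symm y)
      (by rw [RingEquiv.apply_symm_apply]; exact hy)
    refine ⟨(RescaledCompletion.of F (residueChar F v) v (natCast_residueChar_mem F v)).symm ζ, w, ?_, ?_⟩
    · refine (isTorsionUnit_rescaled_iff v (residueChar F v) (natCast_residueChar_mem F v) _).mp ?_
      rw [RingEquiv.apply_symm_apply]
      exact hζ
    · rw [← norm_rescaled_eq_iff v (residueChar F v) (natCast_residueChar_mem F v), h4, map_sub, map_one,
        map_mul, map_pow, hw, RingEquiv.apply_symm_apply, RingEquiv.apply_symm_apply]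
      exact hζy
  · rintro ⟨ζ, w, hζ, hζw⟩
    refine ⟨RescaledCompletion.of F (residueChar F v) v (natCast_residueChar_mem F v) ζ,
      RescaledCompletion.of F (residueChar F v) v (natCast_residueChar_mem F v)
        (((w : ↥(v.adicCompletionIntegers F))) : v.adicCompletion F),
      (isTorsionUnit_rescaled_iff v (residueChar F v) (natCast_residueChar_mem F v) ζ).mpr hζ,
      norm_of_coe_unit_adicCompletionIntegers F (residueChar F v) v (natCast_residueChar_mem F v) w, ?_⟩
    rw [← map_pow, ← map_mul,
      ← map_one (RescaledCompletion.of F (residueChar F v) v (natCast_residueChar_mem F v)), ← map_sub, ← h4,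
      norm_rescaled_eq_iff v (residueChar F v) (natCast_residueChar_mem F v)]
    exact hζw

/-- … so the per-place honest family `Real.iterImage (analyticLogv F) 2` at `v ∣ 2` is inhabited iff the
unit equation is solvable. [claim: Mochizuki2012, status: disputed] -/
theorem iterImage_analyticLogv_two_inr_nonempty_iff_of_residueChar_eq_two (v : HeightOneSpectrum (𝓞 F))
    (h2 : residueChar F v = 2) :
    (iterImage (analyticLogv F) 2 (.inr v : Place F)).Nonempty ↔
      ∃ (ζ : v.adicCompletion F) (w : (↥(v.adicCompletionIntegers F))ˣ), (∃ n : ℕ, 0 < n ∧ ζ ^ n = 1) ∧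
        ‖1 - ζ * (((w : ↥(v.adicCompletionIntegers F))) : v.adicCompletion F) ^ 4‖ =
          ‖(4 : v.adicCompletion F)‖ :=
  nonarchIterImage_analyticLogv_two_nonempty_iff_of_residueChar_eq_two v h2

/-- **`v ∣ 2`, emptiness at all depths**: EVERY honest (Ind3) image of depth `≥ 2` at `v` is EMPTY iff the
unit equation `‖1 − ζ·w⁴‖_v = ‖4‖_v` (`ζ` a root of unity of `K_v`, `w ∈ O_v^×`) has NO solution.
[claim: Mochizuki2012, status: disputed] -/
theorem forall_nonarchIterImage_add_two_eq_empty_iff_of_residueChar_eq_two (v : HeightOneSpectrum (𝓞 F))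
    (h2 : residueChar F v = 2) :
    (∀ k : ℕ, nonarchIterImage (analyticLogv F) v (k + 2) = ∅) ↔
      ∀ (ζ : v.adicCompletion F) (w : (↥(v.adicCompletionIntegers F))ˣ), (∃ n : ℕ, 0 < n ∧ ζ ^ n = 1) →
        ‖1 - ζ * (((w : ↥(v.adicCompletionIntegers F))) : v.adicCompletion F) ^ 4‖ ≠
          ‖(4 : v.adicCompletion F)‖ := by
  have key := nonarchIterImage_analyticLogv_two_nonempty_iff_of_residueChar_eq_two v h2
  have key' := nonarchIterImage_analyticLogv_two_nonempty_iff_exists_unit v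
  rw [forall_nonarchIterImage_add_two_eq_empty_iff_forall_ne_one]
  constructor
  · intro h ζ w hζ heq
    obtain ⟨w', hw'⟩ := key'.mp (key.mpr ⟨ζ, w, hζ, heq⟩)
    exact h w' hw'
  · intro h w hw
    obtain ⟨ζ, w', hζ, heq⟩ := key.mp (key'.mpr ⟨w, hw⟩)
    exact h ζ w' hζ heq

/-- The witness direction in the shape the census files use: a root of unity `ζ ∈ K_v` and a unit `w` with
`‖1 − ζ·w⁴‖_v = ‖4‖_v` make the depth-`2` image at `v ∣ 2` INHABITED. [claim: Mochizuki2012, status: disputed] -/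
theorem nonarchIterImage_analyticLogv_two_nonempty_of_torsion_mul_pow_four (v : HeightOneSpectrum (𝓞 F))
    (h2 : residueChar F v = 2) {ζ : v.adicCompletion F} {n : ℕ} (hn : 0 < n) (hζ : ζ ^ n = 1)
    (w : (↥(v.adicCompletionIntegers F))ˣ)
    (h4 : ‖1 - ζ * (((w : ↥(v.adicCompletionIntegers F))) : v.adicCompletion F) ^ 4‖ =
      ‖(4 : v.adicCompletion F)‖) :
    (nonarchIterImage (analyticLogv F) v 2).Nonempty :=
  (nonarchIterImage_analyticLogv_two_nonempty_iff_of_residueChar_eq_two v h2).mpr ⟨ζ, w, ⟨n, hn, hζ⟩, h4⟩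

/-- The emptiness direction in the shape the census files use: if the unit equation has no solution at
`v ∣ 2`, the honest image of depth `m′ + 2` at `v` is EMPTY. [claim: Mochizuki2012, status: disputed] -/
theorem nonarchIterImage_add_two_eq_empty_of_forall_ne_of_residueChar_eq_two (v : HeightOneSpectrum (𝓞 F))
    (h2 : residueChar F v = 2)
    (h : ∀ (ζ : v.adicCompletion F) (w : (↥(v.adicCompletionIntegers F))ˣ), (∃ n : ℕ, 0 < n ∧ ζ ^ n = 1) →
      ‖1 - ζ * (((w : ↥(v.adicCompletionIntegers F))) : v.adicCompletion F) ^ 4‖ ≠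
        ‖(4 : v.adicCompletion F)‖)
    (k : ℕ) : nonarchIterImage (analyticLogv F) v (k + 2) = ∅ :=
  (forall_nonarchIterImage_add_two_eq_empty_iff_of_residueChar_eq_two v h2).mpr h k

/-! ## 4. Packet level -/

/-- **Packet level**: the pure-tensor unit image of the honest components at depth `m′ + 2` is EMPTY at
`v_ℚ = 2` as soon as SOME place `w ∣ 2` of the fibre admits no solution of the unit equation.
[claim: Mochizuki2012, status: disputed] -/
theorem tprodImages_honestU_add_two_eq_empty_of_forall_ne_of_residueChar_eq_two (X : PilotData F) (m : ℤ)
    (n : ℕ) (j : (thetaIndex X).Label) {vQ : (thetaIndex X).VQ}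
    (w : HeightOneSpectrum (𝓞 F)) (hw : (thetaIndex X).over (.inr w) = vQ) (h2 : residueChar F w = 2)
    (h : ∀ (ζ : w.adicCompletion F) (u : (↥(w.adicCompletionIntegers F))ˣ), (∃ n : ℕ, 0 < n ∧ ζ ^ n = 1) →
      ‖1 - ζ * (((u : ↥(w.adicCompletionIntegers F))) : w.adicCompletion F) ^ 4‖ ≠
        ‖(4 : w.adicCompletion F)‖) :
    (logShellsDH X (analyticLogv F)).tprodImages j vQ (honestU X (analyticLogv F) m (n + 2) vQ) = ∅ :=
  LogShells.tprodImages_eq_empty_of_eq_empty _ j vQ _ ⟨.inr w, hw⟩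
    (nonarchIterImage_add_two_eq_empty_of_forall_ne_of_residueChar_eq_two w h2 h n)

end Summit.ABC.IUTFork.Thm311.Real

end
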